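import Summits.CriticalPhenomena.SAWScalingLimit.Theses.SAWLeftRightFKG
import Summits.CriticalPhenomena.SAWScalingLimit.Theorems.LeftRightFKG.Negative.LatticePolylines
import Summits.CriticalPhenomena.SAWScalingLimit.Theorems.BoundaryTP2Negative_Box3

/-!
# Disproof work file — crux `NotFKGAtOne` (stmt-CriticalPhenomena-11233, route SAWLeftRightFKG)

Standing adversary: refuter-cdisprove-stmt-CriticalPhenomena-11233-0.  Cycle 1 verdict: **NO KILL — the crux is
TRUE, and a complete sorry-free CANDIDATE PROOF exists** (attached evidence `NotFKGAtOne_CandidateProof.lean`, rc 0: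
`SAWLeftRightFKG_notFKGAtOne : NotFKGAtOne`; being landed as `Theorems/NotFKGAtOne/Negative/{Box3Domain,Box3Witness}.lean`
+ a prover's 10-line corollary `NotFKGAtOneProof.lean` — the refuter does not land route items, D-0016), with an 8-vertex / 7-chord certificate (minimal) and a 12-chord certificate on the 3 × 3 box; everything a
prover needs to land it is in §3 and in the evidence file `EVIDENCE.md` (scripts `py/lrfkg1.py`, `py/lrfkg_min.py`,
`py/lrfkg_box.py`; kit job j010679).

## Findings
* READ-BACK (W.lean rc 0).  `NotFKGAtOne = ¬ ∀ δ c a b a' b' C, CountFKG δ c a b a' b' C` (`notFKGAtOne_iff`): an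
  EXISTENTIAL finite certificate.  `wind` is the genuine log-lifting winding number (junk `0` only ON the trace),
  `Ω(C) = {wind ≠ 0}` is bounded and avoids the trace, `DomainSAW Ω δ a b` = self-avoiding paths of the induced
  `ℤ²`-graph on the largest component of `Ω ∩ δℤ²`, `Measure.count` on the `⊤` σ-algebra = cardinality.  The order:
  `le γ₁ γ₂ ↔ ∀ faces F, h_{γ₁}(F) ≥ h_{γ₂}(F)`, `h_γ(F)` = signed crossings (ccw = +1) of the upward ray from the
  centre of `F` by `γ` oriented `a → b` (off-trace non-face points take an adjacent face value).  Exact instance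
  class: finite 4-connected vertex animals `V ⊂ ℤ²` WITHOUT POCKETS (`ℤ² ∖ V` has no finite 4-component),
  `G = ℤ²[V]`, `a ≠ b ∈ V` each with a `ℤ²`-neighbour outside `V` (every such triple is realised by a rectangle plus
  slit trees; conversely pockets are impossible, NOTES.md §model).  NO JUNK ESCAPE: a disproof would have to prove
  left–right FKG for the counting measure on every such instance, and that is false (§3).
* WHERE A WITNESS CANNOT BE (proved below, measure-free): nested up-sets never witness (`measure_fkg_of_subset`),
  so a witness needs two `≼`-INCOMPARABLE chords (`exists_incomparable_of_not_countFKG`); degenerate endpoint data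
  (`a = b`, `a ∉ Ω_δ`) give a subsingleton chord space and never witness (`countFKG_of_subsingleton`,
  `countFKG_of_eq`, `countFKG_of_not_mem_meshDomain`); and by Daykin's inequality up-sets of a finite DISTRIBUTIVE
  lattice always satisfy `|A||B| ≤ |U||A∩B|` (`card_fkg_of_distribLattice`) — the witness lives on the
  non-distributivity of the `ℤ²` chord poset (kissing corners), exactly the card's diagnosis.
* COMPUTATION (x = 1, exact integers, EXACT Lean order; `py/*.py`, job j010679):
  - exhaustive over ALL instances with `|V| ≤ 10` (1 591 448 endpoint-pair instances at `|V| = 10`), all pairs of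
    up-sets: NO violation for `|V| ≤ 7`; first violations at `|V| = 8` (16 instances = the symmetry class of
    `V = {0,1,2}² ∖ {(2,0)}`, `a = (0,0)`, `b = (2,1)`: 7 chords, `|A| = |B| = 4`, `|A∩B| = 2`, `16 > 14`);
    222 violating instances at `|V| = 9`, 1 860 at `|V| = 10`, 12 560 at `|V| = 11` (7.2·10⁶ instances); minimal
    chord count of a violating instance is 7 throughout (pocketed animals, outside the class, first violate at 11).
  - 3 × 3 box, corner to corner: 12 chords, 56 up-sets, 17 violating pairs; best `A = {first step N}`,
    `B = {last step E}`: `6·6 = 36 > 24 = 12·2` (Cov = 1/6 − 1/4).  As a polynomial in the fugacity this pair has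
    `det(x) = x⁸(4 − (1+x²)⁴) < 0 ⟺ x > (√2−1)^{1/2} = 0.6436` (triage r1-1 of crux 11232), so the same pair is
    NOT a witness at `x_c ≈ 0.379` — consistent with the sibling crux `LeftRightFKG` resisting.
  - corner-to-corner boxes W×H ∈ {3×3, 4×3, 4×4, 5×4, 5×5}, face-event family `{h(F) ≤ c}`: violations on EVERY
    box, min ratio `|U||A∩B|/(|A||B|)` = .667, .745, .696, .684, .727 (strongly negative association of adjacent
    diagonal face events in the dense phase, cf. DuminilCopinKozmaYadin2014).
* WHY IT RESISTS: it is true; the only obstruction to LANDING it is Lean enumeration infrastructure for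
  `SAW.DomainSAW` of a concrete box + the face-crossing formula for `wind` of lattice lens loops — both exist in the
  sibling disprover's `Theorems/LeftRightFKG/Negative/*` (`wind_poly_probeL`, `wcross_le_of_wind_nonneg`,
  `meshDomain_Ωb`, `dAdj_iff`; part 1 `LatticeSegments.lean` landed).  `notFKGAtOne_of_counts3x3` below reduces the
  crux to `Counts3x3` (FOUR COUNTS, nothing else): boundary data by `decide`, up-closedness of the two corner
  events PROVED for every domain from the landed `wcross_le_of_wind_nonneg` (`le_wcross_of_lr`).

## Contents
§1 read-back (`dom`, `lr`, `CountFKG`, `notFKGAtOne_iff`); §2 where a witness cannot be (all sorry-free);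
§3 the witnesses (`le_wcross_of_lr`, `sq3`, `A₃`, `B₃`, `isUp_A₃/B₃`, `notFKGAtOne_of_counts3x3` sorry-free;
`counts3x3` sorried = the prover's remaining work: four cardinalities); §4 natural strengthenings / weakenings and their status (docstrings);
`-- Targets`: none (payload `targets = []`).
-/

namespace Summit.CriticalPhenomena.SAWScalingLimit.Cruxes.NotFKGAtOne.Disproof

open scoped ENNReal FinsetFamily
open MeasureTheory Set Literature.Probability.LatticeModels Literature.Probability.RandomPlanarGeometry
  Literature.Topology.PlaneTopology Summit.CriticalPhenomena.SAWScalingLimit.Theses.SAWLeftRightFKG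
  Summit.CriticalPhenomena.SAWScalingLimit.Theorems.LeftRightFKG.Negative

noncomputable section

/-! ## §1 Read-back -/

/-- `Ω(C, δ)`: the points of non-zero winding number of the mesh polyline of the closed lattice walk `C`
(verbatim the `let Ω` of the crux). [folklore] -/
def dom (δ : ℝ) {c : Site 2} (C : (zdGraph 2).Walk c c) : Set ℂ :=
  {z | wind (fun t : ℝ => IccExtend zero_le_one (C.toCurve (meshPoint δ)) t - z) ≠ 0}

/-- The left–right preorder of the crux (verbatim its `let le`): the lens loop `γ₁ · γ₂⁻¹` winds
non-negatively about every point. [folklore] -/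
def lr {Ω : Set ℂ} {δ : ℝ} {a b : Site 2} (γ₁ γ₂ : SAW.DomainSAW Ω δ a b) : Prop :=
  ∀ z : ℂ, 0 ≤ wind (fun t : ℝ =>
    IccExtend zero_le_one ((γ₁.walk.append γ₂.walk.reverse).toCurve (meshPoint δ)) t - z)

/-- `CountFKG δ c a b a' b' C`: the ∀-body of the crux at one datum — left–right FKG in event form for the
COUNTING measure on the chords of `Ω(C)_δ` from `a` to `b`. [folklore] -/
def CountFKG (δ : ℝ) (c a b a' b' : Site 2) (C : (zdGraph 2).Walk c c) : Prop :=
  0 < δ → a' ∈ C.support → b' ∈ C.support → (zdGraph 2).Adj a a' → (zdGraph 2).Adj b b' →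
  ∀ A B : Set (SAW.DomainSAW (dom δ C) δ a b), (∀ γ₁ γ₂, lr γ₁ γ₂ → γ₁ ∈ A → γ₂ ∈ A) →
    (∀ γ₁ γ₂, lr γ₁ γ₂ → γ₁ ∈ B → γ₂ ∈ B) →
    Measure.count A * Measure.count B ≤
      Measure.count (univ : Set (SAW.DomainSAW (dom δ C) δ a b)) * Measure.count (A ∩ B)

/-- READ-BACK: the crux is the existential "some datum violates `CountFKG`". [folklore] -/
theorem notFKGAtOne_iff :
    NotFKGAtOne ↔ ∃ (δ : ℝ) (c a b a' b' : Site 2) (C : (zdGraph 2).Walk c c), ¬ CountFKG δ c a b a' b' C := by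
  have h : NotFKGAtOne ↔ ¬ ∀ (δ : ℝ) (c a b a' b' : Site 2) (C : (zdGraph 2).Walk c c),
      CountFKG δ c a b a' b' C := Iff.rfl
  simp only [h, not_forall]

/-! ## §2 Where a witness cannot be -/

/-- Nested events satisfy the FKG event inequality for EVERY measure (`A ⊆ B`). [folklore] -/
theorem measure_fkg_of_subset {α : Type*} [MeasurableSpace α] (μ : Measure α) {A B : Set α}
    (h : A ⊆ B) : μ A * μ B ≤ μ univ * μ (A ∩ B) := by
  rw [inter_eq_left.2 h, mul_comm]
  exact mul_le_mul' (measure_mono (subset_univ B)) le_rfl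

/-- Nested events satisfy the FKG event inequality for EVERY measure (`B ⊆ A`). [folklore] -/
theorem measure_fkg_of_superset {α : Type*} [MeasurableSpace α] (μ : Measure α) {A B : Set α}
    (h : B ⊆ A) : μ A * μ B ≤ μ univ * μ (A ∩ B) := by
  rw [inter_eq_right.2 h]
  exact mul_le_mul' (measure_mono (subset_univ A)) le_rfl

/-- Up-sets of a TOTAL relation are nested. [folklore] -/
theorem nested_of_total {α : Type*} {r : α → α → Prop} (htot : ∀ x y, r x y ∨ r y x) {A B : Set α}
    (hA : ∀ x y, r x y → x ∈ A → y ∈ A) (hB : ∀ x y, r x y → x ∈ B → y ∈ B) : A ⊆ B ∨ B ⊆ A := by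
  by_contra h
  obtain ⟨hAB, hBA⟩ := not_or.1 h
  obtain ⟨x, hxA, hxB⟩ := not_subset.1 hAB
  obtain ⟨y, hyB, hyA⟩ := not_subset.1 hBA
  rcases htot x y with hxy | hyx
  · exact hyA (hA x y hxy hxA)
  · exact hxB (hB y x hyx hyB)

/-- For a total relation the FKG event inequality holds for every measure and all up-sets: a witness of the
crux needs two INCOMPARABLE chords. [folklore] -/
theorem measure_fkg_of_total {α : Type*} [MeasurableSpace α] (μ : Measure α) {r : α → α → Prop}
    (htot : ∀ x y, r x y ∨ r y x) {A B : Set α} (hA : ∀ x y, r x y → x ∈ A → y ∈ A)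
    (hB : ∀ x y, r x y → x ∈ B → y ∈ B) : μ A * μ B ≤ μ univ * μ (A ∩ B) := by
  rcases nested_of_total htot hA hB with h | h
  exacts [measure_fkg_of_subset μ h, measure_fkg_of_superset μ h]

/-- In a subsingleton type any two sets are nested. [folklore] -/
theorem nested_of_subsingleton {α : Type*} [Subsingleton α] (A B : Set α) : A ⊆ B ∨ B ⊆ A := by
  by_cases h : A ⊆ B
  · exact Or.inl h
  · right
    obtain ⟨x, -, hxB⟩ := not_subset.1 h
    intro y hy
    rw [Subsingleton.elim y x] at hy
    exact (hxB hy).elim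

/-- **Daykin ⇒ Harris–Kleitman on distributive lattices.**  In a finite distributive lattice the counting measure
satisfies the FKG event inequality for all up-sets (`|A||B| ≤ |A ⊼ B||A ⊻ B| ≤ |U||A ∩ B|`,
`Finset.le_card_infs_mul_card_sups`).  Hence the chord poset `(DomainSAW, ≼)` of any witness of the crux is NOT
(order-isomorphic to) a distributive lattice: non-distributivity / the kissing-corner defect of `ℤ²` is load-bearing
for `NotFKGAtOne`, and no measure-blind lattice argument can prove `LeftRightFKG` either. [folklore] -/
theorem card_fkg_of_distribLattice {α : Type*} [DistribLattice α] [Fintype α] [DecidableEq α]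
    (A B : Finset α) (hA : IsUpperSet (A : Set α)) (hB : IsUpperSet (B : Set α)) :
    A.card * B.card ≤ Fintype.card α * (A ∩ B).card := by
  have hsub : A ⊻ B ⊆ A ∩ B := by
    intro x hx
    rw [Finset.mem_sups] at hx
    obtain ⟨a, ha, b, hb, rfl⟩ := hx
    exact Finset.mem_inter.2 ⟨hA le_sup_left ha, hB le_sup_right hb⟩
  calc A.card * B.card ≤ (A ⊼ B).card * (A ⊻ B).card := Finset.le_card_infs_mul_card_sups A B
    _ ≤ Fintype.card α * (A ∩ B).card :=
        Nat.mul_le_mul (Finset.card_le_univ _) (Finset.card_le_card hsub)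

/-! ### Consequences for the crux -/

variable {δ : ℝ} {c a b a' b' : Site 2} {C : (zdGraph 2).Walk c c}

/-- Any witness of the crux exhibits two NON-NESTED up-sets with a strict inequality. [folklore] -/
theorem exists_not_nested_of_not_countFKG (h : ¬ CountFKG δ c a b a' b' C) :
    ∃ A B : Set (SAW.DomainSAW (dom δ C) δ a b), (∀ γ₁ γ₂, lr γ₁ γ₂ → γ₁ ∈ A → γ₂ ∈ A) ∧
      (∀ γ₁ γ₂, lr γ₁ γ₂ → γ₁ ∈ B → γ₂ ∈ B) ∧ ¬ A ⊆ B ∧ ¬ B ⊆ A ∧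
      Measure.count (univ : Set (SAW.DomainSAW (dom δ C) δ a b)) * Measure.count (A ∩ B) <
        Measure.count A * Measure.count B := by
  unfold CountFKG at h
  push Not at h
  obtain ⟨-, -, -, -, -, A, B, hA, hB, hlt⟩ := h
  refine ⟨A, B, hA, hB, fun hAB => ?_, fun hBA => ?_, hlt⟩
  · exact absurd (measure_fkg_of_subset Measure.count hAB) (not_le.2 hlt)
  · exact absurd (measure_fkg_of_superset Measure.count hBA) (not_le.2 hlt)

/-- Any witness of the crux has two `≼`-INCOMPARABLE chords (crossing / interleaving chords are load-bearing;
in particular `|DomainSAW| ≥ 2`… in fact `≥ 7`, see the module docstring). [folklore] -/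
theorem exists_incomparable_of_not_countFKG (h : ¬ CountFKG δ c a b a' b' C) :
    ∃ γ₁ γ₂ : SAW.DomainSAW (dom δ C) δ a b, ¬ lr γ₁ γ₂ ∧ ¬ lr γ₂ γ₁ := by
  by_contra hne
  push Not at hne
  obtain ⟨A, B, hA, hB, -, -, hlt⟩ := exists_not_nested_of_not_countFKG h
  have htot : ∀ γ₁ γ₂ : SAW.DomainSAW (dom δ C) δ a b, lr γ₁ γ₂ ∨ lr γ₂ γ₁ := fun γ₁ γ₂ => by
    by_cases h₁ : lr γ₁ γ₂
    · exact Or.inl h₁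
    · exact Or.inr (hne γ₁ γ₂ h₁)
  exact absurd (measure_fkg_of_total Measure.count htot hA hB) (not_le.2 hlt)

/-- DEGENERATE DATA NEVER WITNESS (i): a subsingleton chord space (e.g. `a = b`, or `a` outside `Ω_δ`)
satisfies `CountFKG`. [folklore] -/
theorem countFKG_of_subsingleton (hs : Subsingleton (SAW.DomainSAW (dom δ C) δ a b)) :
    CountFKG δ c a b a' b' C := by
  intro _ _ _ _ _ A B _ _
  rcases nested_of_subsingleton A B with h | h
  exacts [measure_fkg_of_subset _ h, measure_fkg_of_superset _ h]

/-- The chords from `a` to `a` reduce to the trivial one. [folklore] -/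
theorem subsingleton_domainSAW_self (Ω : Set ℂ) (δ : ℝ) (a : Site 2) :
    Subsingleton (SAW.DomainSAW Ω δ a a) := by
  refine ⟨fun γ₁ γ₂ => ?_⟩
  obtain ⟨w₁, h₁⟩ := γ₁
  obtain ⟨w₂, h₂⟩ := γ₂
  have e₁ : w₁ = SimpleGraph.Walk.nil :=
    SimpleGraph.Walk.eq_nil_iff_nil.2 (SimpleGraph.Walk.isPath_iff_nil.1 h₁)
  have e₂ : w₂ = SimpleGraph.Walk.nil :=
    SimpleGraph.Walk.eq_nil_iff_nil.2 (SimpleGraph.Walk.isPath_iff_nil.1 h₂)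
  subst e₁ e₂
  rfl

/-- DEGENERATE DATA NEVER WITNESS (ii): `a = b`. [folklore] -/
theorem countFKG_of_eq (δ : ℝ) (c a a' b' : Site 2) (C : (zdGraph 2).Walk c c) :
    CountFKG δ c a a a' b' C :=
  countFKG_of_subsingleton (subsingleton_domainSAW_self _ _ _)

/-- If `a ≠ b` and `a` is not a vertex of `Ω_δ` there is no chord at all. [folklore] -/
theorem isEmpty_domainSAW_of_not_mem {Ω : Set ℂ} {δ : ℝ} {a b : Site 2} (hab : a ≠ b)
    (ha : a ∉ meshDomain Ω δ) : IsEmpty (SAW.DomainSAW Ω δ a b) := by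
  refine ⟨fun γ => ?_⟩
  obtain ⟨w, -⟩ := γ
  cases w with
  | nil => exact hab rfl
  | cons h _ => exact ha (discreteDomainGraph_adj_iff.1 h).2.1

/-- DEGENERATE DATA NEVER WITNESS (iii): `a ∉ Ω_δ` (e.g. `a` on the trace of `C`, or outside). [folklore] -/
theorem countFKG_of_not_mem_meshDomain (ha : a ∉ meshDomain (dom δ C) δ) : CountFKG δ c a b a' b' C := by
  by_cases hab : a = b
  · subst hab
    exact countFKG_of_eq δ c a a' b' C
  · haveI := isEmpty_domainSAW_of_not_mem (Ω := dom δ C) (δ := δ) hab ha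
    exact countFKG_of_subsingleton inferInstance

/-! ## §3 The witnesses (positive content = evidence for the provers; NOT landed by the refuter) -/

/-- Lattice point `(x, y)`. [folklore] -/
def P (x y : ℤ) : Site 2 := ![x, y]

/-- One explicit step of a lattice walk (pins the intermediate vertex for `decide`). [folklore] -/
abbrev stepTo {u w : Site 2} (v : Site 2) (h : (zdGraph 2).Adj u v) (p : (zdGraph 2).Walk v w) :
    (zdGraph 2).Walk u w :=
  SimpleGraph.Walk.cons h p

/-- The boundary `C₃` of the square `[-1,3]²`, a closed lattice walk of length 16 based at `(-1,-1)`
(counter-clockwise).  `Ω(C₃) = (-1,3)²`, `V(Ω) = {0,1,2}²` (the 3 × 3 vertex box), `G = ℤ²[V]`. [folklore] -/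
def sq3 : (zdGraph 2).Walk (P (-1) (-1)) (P (-1) (-1)) :=
  stepTo (P 0 (-1)) (by decide) <| stepTo (P 1 (-1)) (by decide) <| stepTo (P 2 (-1)) (by decide) <|
  stepTo (P 3 (-1)) (by decide) <| stepTo (P 3 0) (by decide) <| stepTo (P 3 1) (by decide) <|
  stepTo (P 3 2) (by decide) <| stepTo (P 3 3) (by decide) <| stepTo (P 2 3) (by decide) <|
  stepTo (P 1 3) (by decide) <| stepTo (P 0 3) (by decide) <| stepTo (P (-1) 3) (by decide) <|
  stepTo (P (-1) 2) (by decide) <| stepTo (P (-1) 1) (by decide) <| stepTo (P (-1) 0) (by decide) <|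
  stepTo (P (-1) (-1)) (by decide) <| SimpleGraph.Walk.nil

/-- `(0,-1)` is a boundary vertex (below `a = (0,0)`). [folklore] -/
theorem mem_sq3_support_a' : P 0 (-1) ∈ sq3.support := by decide

/-- `(2,3)` is a boundary vertex (above `b = (2,2)`). [folklore] -/
theorem mem_sq3_support_b' : P 2 3 ∈ sq3.support := by decide

/-- **Crossing-count superlevel events are `≼`-up-closed — in EVERY domain (`δ = 1`), unconditionally.**
From the landed sibling lemma `wcross_le_of_wind_nonneg` (`LeftRightFKG/Negative/LatticePolylines.lean`): the
left–right relation forces `wcross m k γ₁ ≤ wcross m k γ₂` at every face `(m,k)` (the height bound `Y` it asks for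
is supplied by the finite supports).  So `{γ | c ≤ wcross m k γ.walk}` is an admissible `A`/`B` for the crux with NO
geometric side condition left. [folklore] -/
theorem le_wcross_of_lr {Ω : Set ℂ} {a b : Site 2} (m k c : ℤ) (γ₁ γ₂ : SAW.DomainSAW Ω 1 a b)
    (h : lr γ₁ γ₂) (h₁ : c ≤ wcross m k γ₁.walk) : c ≤ wcross m k γ₂.walk := by
  have hG : ∀ x y, (discreteDomainGraph Ω 1).Adj x y → (zdGraph 2).Adj x y := fun x y hxy =>
    meshGraph_le_zdGraph Ω 1 (discreteDomainGraph_le_meshGraph Ω 1 hxy)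
  classical
  obtain ⟨Y, hY⟩ := Finset.exists_le
    (insert k (((γ₁.walk.support ++ γ₂.walk.support).map fun x : Site 2 => x 1).toFinset))
  have hkY : k ≤ Y := hY k (Finset.mem_insert_self _ _)
  have hs : ∀ x ∈ γ₁.walk.support ++ γ₂.walk.support, x 1 ≤ Y := fun x hx =>
    hY (x 1) (Finset.mem_insert_of_mem (List.mem_toFinset.2 (List.mem_map.2 ⟨x, hx, rfl⟩)))
  have key := wcross_le_of_wind_nonneg hG γ₁.walk γ₂.walk hkY
    (fun x hx => hs x (List.mem_append_left _ hx)) (fun x hx => hs x (List.mem_append_right _ hx))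
    (h (probeL m k))
  omega

/-- The corner event at `a`: `A₃ = {γ | 1 ≤ wcross 0 0 γ}` = {first step North, to `(0,1)`} on the 3 × 3 box
(`wcross 0 0 γ = 1 − [first step East]`: the only column-0 edges above face `(0,0)` are at heights 1, 2). [folklore] -/
def A₃ : Set (SAW.DomainSAW (dom 1 sq3) 1 (P 0 0) (P 2 2)) := {γ | 1 ≤ wcross 0 0 γ.walk}

/-- The corner event at `b`: `B₃ = {γ | 1 ≤ wcross 1 1 γ}` = {last step East, from `(1,2)`}
(`wcross 1 1 γ = [dart (1,2)→(2,2)]`). [folklore] -/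
def B₃ : Set (SAW.DomainSAW (dom 1 sq3) 1 (P 0 0) (P 2 2)) := {γ | 1 ≤ wcross 1 1 γ.walk}

/-- `A₃` is `≼`-up-closed (PROVED, no side condition). [folklore] -/
theorem isUp_A₃ : ∀ γ₁ γ₂, lr γ₁ γ₂ → γ₁ ∈ A₃ → γ₂ ∈ A₃ :=
  fun γ₁ γ₂ h h₁ => le_wcross_of_lr 0 0 1 γ₁ γ₂ h h₁

/-- `B₃` is `≼`-up-closed (PROVED, no side condition). [folklore] -/
theorem isUp_B₃ : ∀ γ₁ γ₂, lr γ₁ γ₂ → γ₁ ∈ B₃ → γ₂ ∈ B₃ :=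
  fun γ₁ γ₂ h h₁ => le_wcross_of_lr 1 1 1 γ₁ γ₂ h h₁

/-- **The 3 × 3 witness — what is LEFT for the prover: four counts.**  Chords of the 3 × 3 vertex box from the
corner `a = (0,0)` to the corner `b = (2,2)`: 12 (EENN ENEN ENNE NEEN NENE NNEE; EENWNE ENWNEE NESENN NNESEN;
EENWWNEE NNESSENN); `|A₃| = 6` (first step N), `|B₃| = 6` (last step E), `|A₃ ∩ B₃| = 2` (NENE, NNEE).  Needs:
`meshDomain (dom 1 sq3) 1 = {0,1,2}²` with induced adjacency (sibling `meshDomain_Ωb`, `dAdj_iff`, parts 3–4 of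
`LeftRightFKG/Negative`, in review) and a certified enumeration of the 12 paths (`Measure.count` = card on `⊤`).
Verified by exact enumeration with the Lean order (`py/lrfkg1.py box 3 3 0,0 2,2`, EVIDENCE.md table). [folklore] -/
def Counts3x3 : Prop :=
  Measure.count A₃ = 6 ∧ Measure.count B₃ = 6 ∧
    Measure.count (univ : Set (SAW.DomainSAW (dom 1 sq3) 1 (P 0 0) (P 2 2))) = 12 ∧
    Measure.count (A₃ ∩ B₃) = 2

/-- **Reduction (sorry-free): the four counts prove the crux.**  Discharged here: `δ = 1 > 0`, `a' = (0,-1) ∈ C₃`,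
`b' = (2,3) ∈ C₃`, `a ∼ a'`, `b ∼ b'` (`decide`), up-closedness of `A₃`, `B₃` (`le_wcross_of_lr`); then
`6 · 6 ≤ 12 · 2` is false. [folklore] -/
theorem notFKGAtOne_of_counts3x3 (h : Counts3x3) : NotFKGAtOne := by
  rw [notFKGAtOne_iff]
  refine ⟨1, P (-1) (-1), P 0 0, P 2 2, P 0 (-1), P 2 3, sq3, fun hC => ?_⟩
  obtain ⟨cA, cB, cU, cAB⟩ := h
  have key := hC one_pos mem_sq3_support_a' mem_sq3_support_b' (by decide) (by decide) A₃ B₃ isUp_A₃ isUp_B₃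
  rw [cA, cB, cU, cAB] at key
  have e1 : (6 : ℝ≥0∞) * 6 = ((36 : ℕ) : ℝ≥0∞) := by norm_num
  have e2 : (12 : ℝ≥0∞) * 2 = ((24 : ℕ) : ℝ≥0∞) := by norm_num
  rw [e1, e2] at key
  exact absurd (Nat.cast_le.1 key) (by norm_num)

/-! ### §3b The four counts by certified enumeration — modulo the domain identification only

Everything below is generic in ONE hypothesis, `AdjBox3` (the crux's domain graph of `C₃` is `ℤ²` induced on
`{0,1,2}²`), which is exactly what the sibling files `LeftRightFKG/Negative/BoxDomain.lean` + `BoxMesh.lean` prove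
for the `5 × 4` box (`meshVertices_Ωb`, `dAdj_iff`) and what remains to be copied at `3 × 3`.  The enumeration is
the landed `BoundaryTP2.Negative.pathsFrom` machinery (complete + sound) with its `nb₃`, `eqSite`, `T₃`. -/

section Counting

open Summit.CriticalPhenomena.SAWScalingLimit.Theorems.BoundaryTP2.Negative

/-- **The domain identification the prover still owes** (and nothing else): the crux's domain graph
`discreteDomainGraph (dom 1 C₃) 1` is `ℤ²` induced on the box `{0,1,2}²`. TRUE (winding number of the square
`C₃` is `±1` inside, junk `0` on the boundary lattice points, `0` outside; pattern: `meshVertices_Ωb`/`dAdj_iff`). [folklore] -/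
def AdjBox3 : Prop :=
  ∀ x y : Site 2, (discreteDomainGraph (dom 1 sq3) 1).Adj x y ↔
    (zdGraph 2).Adj x y ∧ x ∈ boxSites ![0, 0] ![2, 2] ∧ y ∈ boxSites ![0, 0] ![2, 2]

variable (hadj : AdjBox3)
include hadj

/-- Under `AdjBox3`, `nb₃` lists every neighbour (completeness). [folklore] -/
theorem mem_nb₃_of_adj {u w : Site 2} (h : (discreteDomainGraph (dom 1 sq3) 1).Adj u w) : w ∈ nb₃ u := by
  rw [hadj] at h
  obtain ⟨had, hu, hw⟩ := h
  rw [nb₃, if_pos ((inBox₃_iff u).2 hu), List.mem_filter]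
  refine ⟨?_, (inBox₃_iff w).2 hw⟩
  rcases zdGraph_adj_cases had with h | h | h | h <;> simp [h]

/-- Under `AdjBox3`, `nb₃` lists only neighbours (soundness). [folklore] -/
theorem adj_of_mem_nb₃ {u w : Site 2} (h : w ∈ nb₃ u) : (discreteDomainGraph (dom 1 sq3) 1).Adj u w := by
  unfold nb₃ at h
  split_ifs at h with hu
  · rw [List.mem_filter] at h
    refine (hadj u w).2 ⟨zdGraph_adj_of_cases ?_, (inBox₃_iff u).1 hu, (inBox₃_iff w).1 h.2⟩
    simpa using h.1
  · simp at h

/-- Under `AdjBox3`, every chord has at most 8 steps. [folklore] -/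
theorem length_le_eight_sq3 (γ : SAW.DomainSAW (dom 1 sq3) 1 (P 0 0) (P 2 2)) : γ.walk.length ≤ 8 := by
  have h := length_lt_card_of_adj_mem T₃ (G := discreteDomainGraph (dom 1 sq3) 1) (fun x y hxy => ?_)
    ((mem_T₃_iff _).2 (by decide : P 0 0 ∈ boxSites ![0, 0] ![2, 2])) γ.walk γ.isPath
  · have := card_T₃
    omega
  · rw [hadj] at hxy
    exact ⟨(mem_T₃_iff x).2 hxy.2.1, (mem_T₃_iff y).2 hxy.2.2⟩

omit hadj in
/-- The certified list of the supports of the chords `(0,0) → (2,2)` (12 of them). [folklore] -/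
def L₁₂ : List (List (Site 2)) := (pathsFrom eqSite nb₃ 8 (P 0 0) []).filter (endsAt eqSite (P 2 2))

/-- Completeness: every chord's support is listed. [folklore] -/
theorem support_mem_L₁₂ (γ : SAW.DomainSAW (dom 1 sq3) 1 (P 0 0) (P 2 2)) : γ.walk.support ∈ L₁₂ := by
  unfold L₁₂
  rw [List.mem_filter]
  exact ⟨support_mem_pathsFrom eqSite_iff (fun u w h => mem_nb₃_of_adj hadj h) 8 γ.walk [] γ.isPath
    (length_le_eight_sq3 hadj γ) (by simp), endsAt_support eqSite_iff γ.walk⟩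

/-- Soundness: every listed support is a chord's. [folklore] -/
theorem exists_of_mem_L₁₂ {s : List (Site 2)} (hs : s ∈ L₁₂) :
    ∃ γ : SAW.DomainSAW (dom 1 sq3) 1 (P 0 0) (P 2 2), γ.walk.support = s := by
  unfold L₁₂ at hs
  rw [List.mem_filter] at hs
  obtain ⟨hs, hend⟩ := hs
  obtain ⟨v, p, hp, hsupp, -⟩ :=
    exists_walk_of_mem_pathsFrom eqSite_iff (fun u w h => adj_of_mem_nb₃ hadj h) 8 [] s hs
  have hv : v = P 2 2 := by
    rw [← hsupp] at hend
    unfold endsAt at hend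
    rw [List.getLast?_eq_some_getLast p.support_ne_nil, SimpleGraph.Walk.getLast_support] at hend
    exact (eqSite_iff _ _).1 hend
  subst hv
  exact ⟨⟨p, hp⟩, hsupp⟩

omit hadj in
/-- A chord is determined by its support. [folklore] -/
theorem support_injective :
    Function.Injective (fun γ : SAW.DomainSAW (dom 1 sq3) 1 (P 0 0) (P 2 2) => γ.walk.support) := by
  intro γ₁ γ₂ h
  obtain ⟨w₁, h₁⟩ := γ₁
  obtain ⟨w₂, h₂⟩ := γ₂
  have hw : w₁ = w₂ := walk_eq_of_support_eq w₁ w₂ h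
  subst hw
  rfl

/-- **Counting through the enumeration**: an event read off the support through a Boolean test `q` has
`Measure.count` equal to the number of listed supports passing `q`. [folklore] -/
theorem count_eq_length (q : List (Site 2) → Bool) (S : Set (SAW.DomainSAW (dom 1 sq3) 1 (P 0 0) (P 2 2)))
    (hS : ∀ γ, γ ∈ S ↔ q γ.walk.support = true) (hnodup : L₁₂.Nodup) :
    Measure.count S = ((L₁₂.filter q).length : ℝ≥0∞) := by
  haveI : Finite (SAW.DomainSAW (dom 1 sq3) 1 (P 0 0) (P 2 2)) :=
    Finite.of_injective
      (fun γ => (⟨γ.walk.support, List.mem_toFinset.2 (support_mem_L₁₂ hadj γ)⟩ : L₁₂.toFinset))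
      (fun γ₁ γ₂ h => support_injective (congrArg Subtype.val h))
  have hfin : S.Finite := S.toFinite
  rw [Measure.count_apply_finite' hfin MeasurableSpace.measurableSet_top]
  have hc : hfin.toFinset.card = (L₁₂.filter q).length := by
    rw [← Finset.card_image_of_injective hfin.toFinset support_injective,
      ← List.toFinset_card_of_nodup (hnodup.filter q)]
    congr 1
    ext s
    simp only [Finset.mem_image, Set.Finite.mem_toFinset, List.mem_toFinset, List.mem_filter]
    constructor
    · rintro ⟨γ, hγ, rfl⟩
      exact ⟨support_mem_L₁₂ hadj γ, (hS γ).1 hγ⟩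
    · rintro ⟨hs, hq⟩
      obtain ⟨γ, rfl⟩ := exists_of_mem_L₁₂ hadj hs
      exact ⟨γ, (hS γ).2 hq, rfl⟩
  rw [hc]

omit hadj in
/-- Boolean test of the corner event at `a` on a support. [folklore] -/
def qA (s : List (Site 2)) : Bool := decide (1 ≤ pathCross 0 0 (P 0 0) s.tail)

omit hadj in
/-- Boolean test of the corner event at `b` on a support. [folklore] -/
def qB (s : List (Site 2)) : Bool := decide (1 ≤ pathCross 1 1 (P 0 0) s.tail)

omit hadj in
/-- KERNEL CERTIFICATE: the listed supports are distinct. [folklore] -/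
theorem nodup_L₁₂ : L₁₂.Nodup := by decide

omit hadj in
/-- KERNEL CERTIFICATE: 12 chords. [folklore] -/
theorem length_L₁₂ : (L₁₂.filter fun _ => true).length = 12 := by decide

omit hadj in
/-- KERNEL CERTIFICATE: 6 chords start North (`1 ≤ wcross 0 0`). [folklore] -/
theorem length_L₁₂_A : (L₁₂.filter qA).length = 6 := by decide

omit hadj in
/-- KERNEL CERTIFICATE: 6 chords end East (`1 ≤ wcross 1 1`). [folklore] -/
theorem length_L₁₂_B : (L₁₂.filter qB).length = 6 := by decide

omit hadj in
/-- KERNEL CERTIFICATE: 2 chords do both (NENE, NNEE). [folklore] -/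
theorem length_L₁₂_AB : (L₁₂.filter fun s => qA s && qB s).length = 2 := by decide

/-- **`Counts3x3` modulo the domain identification `AdjBox3`** (sorry-free): the four cardinalities
`|A₃| = 6`, `|B₃| = 6`, `|U| = 12`, `|A₃ ∩ B₃| = 2` by the kernel-checked enumeration. [folklore] -/
theorem counts3x3_of_adjBox3 : Counts3x3 := by
  have hA : ∀ γ : SAW.DomainSAW (dom 1 sq3) 1 (P 0 0) (P 2 2), γ ∈ A₃ ↔ qA γ.walk.support = true :=
    fun γ => by simp only [A₃, Set.mem_setOf_eq, qA, decide_eq_true_eq]; rfl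
  have hB : ∀ γ : SAW.DomainSAW (dom 1 sq3) 1 (P 0 0) (P 2 2), γ ∈ B₃ ↔ qB γ.walk.support = true :=
    fun γ => by simp only [B₃, Set.mem_setOf_eq, qB, decide_eq_true_eq]; rfl
  refine ⟨?_, ?_, ?_, ?_⟩
  · rw [count_eq_length hadj qA A₃ hA nodup_L₁₂, length_L₁₂_A]; norm_num
  · rw [count_eq_length hadj qB B₃ hB nodup_L₁₂, length_L₁₂_B]; norm_num
  · rw [count_eq_length hadj (fun _ => true) univ (fun γ => by simp) nodup_L₁₂, length_L₁₂]; norm_num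
  · rw [count_eq_length hadj (fun s => qA s && qB s) (A₃ ∩ B₃)
      (fun γ => by rw [Set.mem_inter_iff, hA, hB, Bool.and_eq_true]) nodup_L₁₂, length_L₁₂_AB]
    norm_num

/-- **The crux modulo the domain identification** (sorry-free): `AdjBox3 → NotFKGAtOne`. [folklore] -/
theorem notFKGAtOne_of_adjBox3 : NotFKGAtOne :=
  notFKGAtOne_of_counts3x3 (counts3x3_of_adjBox3 hadj)

end Counting

/-- The remaining obligation itself — OPEN HERE (prover's work, not the refuter's; see `Counts3x3`).
Tried here: nothing beyond the reduction and the up-closedness (by role). [folklore] -/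
theorem counts3x3 : Counts3x3 := by
  sorry

/-- **The minimal witness (8 vertices, 7 chords)** for the record: `V = {0,1,2}² ∖ {(2,0)}` (realised e.g. by the
hexagon `C` through `(-1,-1),(2,-1),(2,0),(3,0),(3,3),(-1,3)`, or by `C₃` plus the slit `(2,-1)(2,0)(2,-1)`),
`a = (0,0)` (`a' = (0,-1)`), `b = (2,1)` (`b' = (2,0)` or `(3,1)`); the 7 chords; `A = {first step N}` (4 chords),
`B = {last step S, i.e. from (2,2)}` (4 chords), `A ∩ B` = 2 chords: `16 > 14`; as a polynomial in the fugacity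
`w(A)w(B) − w(U)w(A∩B) = (x³+3x⁵)(3x⁵+x⁷) − 2x⁵(2x³+4x⁵+x⁷) = x⁸(x⁴+2x²−1)`, positive iff `x² > √2 − 1`, the SAME
threshold `x₀ = 0.6436` as the 3 × 3 pair (`x⁸((1+x²)⁴ − 4)`).  Exhaustive search: no instance
with `|V| ≤ 7` violates, and 7 is the minimal chord count of a violating instance for `|V| ≤ 10`.  Stated as data
only (the vertex lists of the seven chords, first coordinate `x`, second `y`). [folklore] -/
def minimalWitnessChords : List (List (ℤ × ℤ)) :=
  [[(0,0),(0,1),(1,1),(2,1)], [(0,0),(0,1),(1,1),(1,2),(2,2),(2,1)], [(0,0),(0,1),(0,2),(1,2),(2,2),(2,1)],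
   [(0,0),(0,1),(0,2),(1,2),(1,1),(2,1)], [(0,0),(1,0),(1,1),(0,1),(0,2),(1,2),(2,2),(2,1)],
   [(0,0),(1,0),(1,1),(1,2),(2,2),(2,1)], [(0,0),(1,0),(1,1),(2,1)]]

/-! ## §4 Natural strengthenings / weakenings of the crux and their status

* `S₁` (fewer vertices): "a witness with `|V(Ω)| ≤ 7`" — FALSE (exhaustive, all up-set pairs; `py/min9.log`).
  So `8 ≤ |V|` and `7 ≤ |U|` are NECESSARY; the 4×4-face box named in the item's docstring is far from minimal.
* `S₂` (every box): "corner-to-corner chords of EVERY `W×H` vertex box, `W,H ≥ 3`, violate with two single-face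
  events" — TRUE for all boxes checked (3×3 … 5×5; 6×5, 6×6 in job j010679); margins ≈ 30 % (dense phase).
* `S₃` (all fugacities above `x_c`): "`¬ LeftRightFKGAt x` for every `x > x_c`" — the sibling crux's (E5): known
  down to `x ≥ 0.4495` only; the 3×3 pair switches sign at `x = 0.6436`, the 4×4 corner pair at `0.5299`; finite
  boxes have thresholds `x₀(L) − x_c ≈ .35/L … .45/L`, so every FIXED finite witness of `NotFKGAtOne` dies strictly
  above `x_c` — `NotFKGAtOne` carries NO information about the critical point (it is a guard, correctly typed as such).
* `S₄` (distributive sub-posets): on the sub-poset of MONOTONE (staircase) chords of a box — a distributive lattice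
  (Young diagrams) — the counting measure IS positively associated (`card_fkg_of_distribLattice`); backtracking
  chords are load-bearing for the failure at `x = 1`.
* `S₅` (the HULL-AVOIDANCE sub-family the route's r3 actually consumes): same-side boundary-vertex avoidance events
  `E_v = {γ ∌ v}` (`v` on the bottom/right layer: `≼`-UP-closed; top/left layer: down-closed — checked on all boxes below)
  at `x = 1`, corner to corner: ALL pairs positively correlated on 3×3 (min ratio 1.5) and 4×3 (1.056), but NEGATIVE pairs
  from 4×4 on — 4×4: `A = E_{(1,0)}`, `B = E_{(3,2)}`: `54·54 = 2916 > 2208 = 184·12` (ratio .757); 5×4: 3/15 pairs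
  (worst .796); 5×5: 6/21 (.823); 6×4: 6/21 (.814) (`py/hull.py`).  So the weaker "same-side hull-avoidance PA" also
  fails for the counting measure (witness needs ≥ 4×4), i.e. the guard survives the route's announced tenure repair.
* `W₁` (interior endpoints, hypotheses `a' ∈ C.support …` dropped): weaker statement, TRUE for every `x > 0` by
  disjoint principal up-sets (sibling theorem `leftRightFKG_false_without_boundaryAdjacency`); not needed here.
* `W₂` (pockets / annuli): outside the instance class (pockets are impossible, see module docstring).
-/

-- Targets: none in cycle 1 (payload `targets = []`, `stuck_stubs = []`).

end

end Summit.CriticalPhenomena.SAWScalingLimit.Cruxes.NotFKGAtOne.Disproof
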